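import Literature.MathematicalPhysics.QuantumFieldTheory.Balaban1983to89.B9Eq3117HessOpGaugeMode

/-!
# `Balaban1983to89.B9Eq3117DivHessOpGaugeMode` — T. Bałaban, *Propagators for lattice gauge theories in a background field*, Commun. Math. Phys. **99**
# (1985) 389–434 [Balaban1985BackgroundPropagators] (3.117) p. 419 (the gauge variation of the Hessian is the current form) and (3.120) p. 419 ∕ p. 421
# («we have to be careful only with the third term in the definition (3.120) of Δ′_π. One of the three derivatives there has to be applied either to an
# expression on the right, or on the left, of Δ′_π»): **THE TRANSPOSE LETTER — `D^{η*}_U ∘ Δ^η(U)` IS AN ORDER-ZERO STENCIL.**  On the pub-balaban NE9 chain's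
# periodic `L²` carriers, at print's weight `c₀ = η^d` and a unitary background: for every BOND function `A` and every site `x`,
# `(D^{η*}_U(Δ^η(U)A))(x) = φ⁻¹( (i∕2)Σ_μ ( [Ã(x,μ), J(x,μ)] + U(x−e_μ,μ)⁻¹[Ã(x−e_μ,μ), J(x−e_μ,μ)]U(x−e_μ,μ) ) )`, `Ã = φ∘A`, `J = D*η⁻²Im ∂U` the
# current (3.11) — the companion of `B9Eq3117HessOpGaugeMode.equiv_hessOp_covDerivL2K` (`Δ∘D_U` = the current commutator) obtained from it by the bilinear
# adjointness `(B, D_Uλ) = (D*_UB, λ)` and the bilinear symmetry of `Δ^η(U)`; with the pointwise letter `≤ M_φ′j₀M_φΣ_μ(‖A(x,μ)‖ + ‖A(x−e_μ,μ)‖) ≤ 2dM_φM_φ′j₀‖A‖_∞`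
# under print's third window (3.36) in the shape `‖J‖ ≤ j₀`

statement-level skeleton of published theorems with citation tags; proofs where landed; nothing here is a claim about the Yang–Mills mass gap

CITATION HEADER (lean-in-tree rule).  Audit cell `pub-balaban`, sub-cell `t4`, BINDER row NE9; filed by the NE9 BINDER-row OWNER lineage `b2b-balaban-t4-ne9-p1`
(gen 97), plan v15 (journal R-ne9p1-g97-1; ne9-leaf-05 g88 CONSULT C-leaf05-g88-1 (iii) names the two letters `M := hessOp∘D_U` and `M† = D*_U∘hessOp`).  Source
READ first-hand in the held text layer (`paper:balaban1985-cmp99-background-propagators`, journal page = PDF page + 388): p. 392 (3.8)–(3.11), p. 419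
(3.117)–(3.120), p. 421.  COMPOSED BY NAME, nothing restated: this lineage's `B9Eq3117HessOpGaugeMode.equiv_hessOp_covDerivL2K` (the operator form of
r06's kernel-checked (3.117) `B9Eq3117Polarized`), ne9-leaf-05's `B9Eq311TracePairing` (`tpair`, `starW`) and `B9Eq3119DeltaPiCarrier.tpair_hessOp_comm` (the
Hessian is symmetric for the bilinear pairing at a unitary background), this lineage's `B11Eq103H1Complex.adjoint_covDerivL2K` (`D* = D†`),
lit-balaban's `B9Eq310HessianHermitian.adTransportW_adjoint`.

WHAT IS PROVED (sorry-free; proof lane — 0 `def`; [folklore]).  Carrier and MODEL letters exactly as in `B9Eq3117HessOpGaugeMode` (`hτ₂`, `hφ`, `hU : U(b)* =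
U(b)⁻¹`, `η ≠ 0`, `hc₀ : c₀ = η^d`); `D*_U = covDivL2K ℂ c₀ η⁻¹ (adTransportW φ U⁻¹)` — the chain's spelling of (3.8), the Hilbert adjoint of `D_U`.
* §1 `adTransportW_inv_sW`, **`covDivL2K_starW`** (`D*_U` is REAL on the periodic carrier — the `fineP`-specific `B9Eq3119DeltaPiReality.covDivL2K_starW` for every
  `Pd`), **`tpair_covDerivL2K`** — THE BILINEAR ADJOINTNESS `tpair φ τ B (D_Uλ) = tpair φ τ (D*_UB) λ` ((3.8) for the trace pairing (3.11)).
* §2 **`equiv_covDivL2K_hessOp`** — THE TRANSPOSE IDENTITY displayed above; proof: test against every site function `λ` in the FIRST slot of `tpair`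
  (non-degenerate through `starW`), move `D*_U` across (§1), use the symmetry of `Δ^η(U)` (`tpair_hessOp_comm`) and the gauge-mode identity
  `equiv_hessOp_covDerivL2K`, then the trace bookkeeping `τ(Ã(JM − MJ)) = τ([Ã,J]λ₀) + τ(U⁻¹[Ã,J]U·λ₁)` (`M = λ₀ + Uλ₁U⁻¹`) and a re-indexing of the
  transported family along each direction (`shiftEquiv μ`).
* §3 **`norm_equiv_covDivL2K_hessOp_le`** (`≤ M_φ′·j₀·M_φ·Σ_μ(‖A(x,μ)‖ + ‖A(x−e_μ,μ)‖)` under `U ∈ U1`, `‖J‖ ≤ j₀`), `_le_sup` (`≤ 2d·M_φM_φ′j₀·N` for `‖A‖_∞ ≤ N`).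
WHY (cell context).  In `Δ′_π = −(Δ∘D_U)∘P − P†∘(D*_U∘Δ)∘π` (`P = G′_kR_kD*_U`) the SECOND letter is this file's; together with `B9Eq3117HessOpGaugeMode` every
coefficient of the one-step improvement of the (3.130) transfer is a landed one-sided letter times an order-zero stencil of size `j₀` (plan v15; the pair
bootstrap of ne9-leaf-05's (K72) `B9Eq3130TransferPairLetters` consumes the two letters as its `(L)(M; ε, κ)`, `(L)(Mt; ε′, κ)`).  HONEST SCOPE.  Exact
finite-lattice identities and triangle-inequality letters; `hJ` is a HYPOTHESIS of printed shape ((3.36)); stated AT `c₀ = η^d` (see the caveat in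
`B9Eq3117HessOpGaugeMode`); nothing of [B9] (3.36), (3.130)–(3.133), Thm 3.3∕3.12∕3.13 or [B11] (117) is asserted, valued or discharged; «NE9 ⇐ the named
binders»; NE9 NOT PRINTED ∕ NOT PROVED; row WALLED ON A MODEL (O-NE9-1; #5 UNRULED); spine PROVED 0∕9; rung (B)+1 on a finite T⁴ — NOT infinite volume, NOT mass
gap, NOT BetaPertH, NOT Clay.  HONEST DEPENDENCY: continuum YM on T⁴ ⇐ BetaPertH ∧ nine spine estimates (0/9 proved); BetaPertH ⇐ (D1) ∧ (D4) ∧ CAP+tail;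
G-an2-4 gates asym, D1 and NE2/3/4.  NEW file importing ONE module (`B9Eq3117HessOpGaugeMode`, this lineage); nothing modified.  Net new unproved facts: 0.
-/

noncomputable section

set_option autoImplicit false

open scoped InnerProductSpace ComplexConjugate BigOperators
open Complex

namespace Literature.MathematicalPhysics.QuantumFieldTheory.Balaban1983to89.B9Eq3117DivHessOpGaugeMode

open B9SectCLatticeCarrier (Bond DirPair shift unshift shift_unshift unshift_shift)
open B4Sect5Torus (TSite)
open B9Eq311L2Pairing (WL2)
open B9Eq33CovDerivVector (shiftEquiv adTransport adTransport_apply covDeriv_apply covDiv_apply)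
open B11Eq103H1Complex (BondL2K SiteL2K covDerivL2K covDivL2K equiv_covDerivL2K equiv_covDivL2K adjoint_covDerivL2K)
open B9Eq310HessianOperator (toAlg adTransportW adTransportW_apply hessOp)
open B9Eq311TracePairing (starW equiv_starW apply_equiv_starW starW_starW tpair tpair_def tpair_comm tpair_eq_inner_starW
  inner_eq_tpair_starW)
open B9Eq310HessianHermitian (adTransportW_adjoint star_val_inv_of_unitary)
open B9Eq3119DeltaPiCarrier (tpair_hessOp_comm)
open B9Eq3117HessOpGaugeMode (equiv_hessOp_covDerivL2K)

/-! ## §1 Reality of `D^η_U` and `D^{η*}_U` on the periodic carrier (unitary background); the bilinear adjointness `(B, D_Uλ) = (D*_UB, λ)` -/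

section Reality

variable {d : ℕ} {Pd : Fin d → ℕ} {𝔸 : Type*} [NormedRing 𝔸] [NormedAlgebra ℂ 𝔸] [StarRing 𝔸] [StarModule ℂ 𝔸]
  {W : Type*} [NormedAddCommGroup W] [InnerProductSpace ℂ W] [FiniteDimensional ℂ W] (φ : W ≃ₗ[ℂ] 𝔸) {c₀ : ℝ} [Fact (0 < c₀)]
  (τ : 𝔸 →ₗ[ℂ] ℂ) (hτ₂ : ∀ X Y : 𝔸, τ (X * Y) = τ (Y * X))
  (hφ : ∀ X Y : 𝔸, ⟪φ.symm X, φ.symm Y⟫_ℂ = τ (star X * Y)) (η : ℝ) {U : Bond d Pd → 𝔸ˣ}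
  (hU : ∀ b, star (U b : 𝔸) = ((U b)⁻¹ : 𝔸ˣ))

omit [StarModule ℂ 𝔸] [FiniteDimensional ℂ W] [Fact (0 < c₀)] in
/-- The fibre involution `w ↦ φ⁻¹((φw)*)` is additive (subtraction). [folklore] -/
private theorem sW_sub (a b : W) : φ.symm (star (φ (a - b))) = φ.symm (star (φ a)) - φ.symm (star (φ b)) := by
  simp [map_sub, star_sub]

omit [FiniteDimensional ℂ W] [Fact (0 < c₀)] in
/-- The fibre involution `w ↦ φ⁻¹((φw)*)` is conjugate-linear. [folklore] -/
private theorem sW_smul (c : ℂ) (a : W) : φ.symm (star (φ (c • a))) = conj c • φ.symm (star (φ a)) := by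
  simp [map_smul, star_smul]

omit [StarModule ℂ 𝔸] [FiniteDimensional ℂ W] [Fact (0 < c₀)] in
/-- The fibre involution `w ↦ φ⁻¹((φw)*)` commutes with finite sums. [folklore] -/
private theorem sW_sum {α : Type*} (s : Finset α) (g : α → W) :
    φ.symm (star (φ (∑ a ∈ s, g a))) = ∑ a ∈ s, φ.symm (star (φ (g a))) := by
  simp [map_sum, star_sum]

include hU in
omit [StarModule ℂ 𝔸] [FiniteDimensional ℂ W] [Fact (0 < c₀)] in
/-- **`(U⁻¹XU)* = U⁻¹X*U`: `R(U(b)⁻¹)` commutes with the fibre involution at a unitary background** (any periodic carrier). [folklore]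
[cite: Balaban1985BackgroundPropagators, p.390, (3.8) p.392] -/
theorem adTransportW_inv_sW (b : Bond d Pd) (v : W) :
    adTransportW φ (fun b => (U b)⁻¹) b (φ.symm (star (φ v))) = φ.symm (star (φ (adTransportW φ (fun b => (U b)⁻¹) b v))) := by
  simp only [adTransportW_apply, LinearEquiv.apply_symm_apply, star_mul, inv_inv, hU, star_val_inv_of_unitary hU, mul_assoc]

include hU in
omit [FiniteDimensional ℂ W] in
/-- **`D^{η*}_U` IS REAL**: `D*_U(A⋆) = (D*_UA)⋆` at a unitary background with the real scalar `η⁻¹` (the `fineP`-specific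
`B9Eq3119DeltaPiReality.covDivL2K_starW`, here for every periodic carrier `TSite d Pd`). [folklore] [cite: Balaban1985BackgroundPropagators, (3.8) p.392] -/
theorem covDivL2K_starW (A : BondL2K ℂ d Pd c₀ W) :
    covDivL2K ℂ c₀ ((η : ℂ))⁻¹ (adTransportW φ fun b => (U b)⁻¹) (starW φ A) =
      starW φ (covDivL2K ℂ c₀ ((η : ℂ))⁻¹ (adTransportW φ fun b => (U b)⁻¹) A) := by
  apply (WL2.equiv ℂ (fun _ : TSite d Pd => c₀) W).injective
  funext x
  rw [equiv_covDivL2K, equiv_starW, equiv_covDivL2K, covDiv_apply, covDiv_apply, sW_smul, map_inv₀, Complex.conj_ofReal, sW_sum]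
  congr 1
  refine Finset.sum_congr rfl fun μ _ => ?_
  rw [equiv_starW, equiv_starW, adTransportW_inv_sW φ hU, sW_sub]

include hτ₂ hφ hU in
/-- **THE BILINEAR ADJOINTNESS (3.8) for the trace pairing (3.11)**: `tpair φ τ B (D^η_Uλ) = tpair φ τ (D^{η*}_UB) λ` — from the Hilbert adjointness
`adjoint_covDerivL2K` (transporters mutually adjoint by `adTransportW_adjoint`) and the reality of `D*_U`. [folklore]
[cite: Balaban1985BackgroundPropagators, (3.8) p.392, (3.11) p.392] -/
theorem tpair_covDerivL2K (B : BondL2K ℂ d Pd c₀ W) (l : SiteL2K ℂ d Pd c₀ W) :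
    tpair φ τ B (covDerivL2K ℂ c₀ ((η : ℂ))⁻¹ (adTransportW φ U) l) =
      tpair φ τ (covDivL2K ℂ c₀ ((η : ℂ))⁻¹ (adTransportW φ fun b => (U b)⁻¹) B) l := by
  have hc : conj (((η : ℂ))⁻¹) = ((η : ℂ))⁻¹ := by rw [map_inv₀, Complex.conj_ofReal]
  have hRS := adTransportW_adjoint φ τ hτ₂ hU hφ
  rw [tpair_eq_inner_starW φ τ hφ, tpair_eq_inner_starW φ τ hφ, ← LinearMap.adjoint_inner_left, adjoint_covDerivL2K _ hc _ _ hRS,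
    covDivL2K_starW φ η hU]

end Reality

/-! ## §2 The transpose letter: `D^{η*}_U ∘ Δ^η(U)` is the ORDER-ZERO stencil `A ↦ (i∕2)Σ_μ([Ã,J](x,μ) + R(U(x−e_μ,μ)⁻¹)[Ã,J](x−e_μ,μ))` -/

section DivHess

variable {d : ℕ} {Pd : Fin d → ℕ} {𝔸 : Type*} [NormedRing 𝔸] [NormedAlgebra ℂ 𝔸] [StarRing 𝔸] [StarModule ℂ 𝔸]
  {W : Type*} [NormedAddCommGroup W] [InnerProductSpace ℂ W] [FiniteDimensional ℂ W] (φ : W ≃ₗ[ℂ] 𝔸) {c₀ : ℝ} [Fact (0 < c₀)]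
  (τ : 𝔸 →ₗ[ℂ] ℂ) (hτ₂ : ∀ X Y : 𝔸, τ (X * Y) = τ (Y * X))
  (hφ : ∀ X Y : 𝔸, ⟪φ.symm X, φ.symm Y⟫_ℂ = τ (star X * Y)) {η : ℝ} (hη : η ≠ 0) {U : Bond d Pd → 𝔸ˣ}
  (hU : ∀ b, star (U b : 𝔸) = ((U b)⁻¹ : 𝔸ˣ)) (hc₀ : c₀ = η ^ d)

omit [NormedAlgebra ℂ 𝔸] [StarRing 𝔸] [StarModule ℂ 𝔸] in
/-- The trace bookkeeping behind the transpose: `τ(Ã·(J·M − M·J))` with `M = λ₀ + uλ₁u⁻¹` is `τ([Ã,J]·λ₀) + τ(u⁻¹[Ã,J]u·λ₁)` (traciality). [folklore] -/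
private theorem trace_transpose {𝔸 : Type*} [Ring 𝔸] [Algebra ℂ 𝔸] (τ : 𝔸 →ₗ[ℂ] ℂ) (hτ₂ : ∀ X Y : 𝔸, τ (X * Y) = τ (Y * X))
    (Af Jv l₀ l₁ u uinv : 𝔸) :
    τ (Af * (Jv * (l₀ + u * l₁ * uinv) - (l₀ + u * l₁ * uinv) * Jv)) =
      τ ((Af * Jv - Jv * Af) * l₀) + τ (uinv * (Af * Jv - Jv * Af) * u * l₁) := by
  have e1 : τ (Af * (l₀ * Jv)) = τ (Jv * (Af * l₀)) := by rw [← mul_assoc, hτ₂]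
  have e2 : τ (Af * (Jv * (u * (l₁ * uinv)))) = τ (uinv * (Af * (Jv * (u * l₁)))) := by
    rw [← hτ₂ (Af * (Jv * (u * l₁))) uinv]; simp only [mul_assoc]
  have e3 : τ (Af * (u * (l₁ * (uinv * Jv)))) = τ (uinv * (Jv * (Af * (u * l₁)))) := by
    rw [show Af * (u * (l₁ * (uinv * Jv))) = (Af * (u * l₁)) * (uinv * Jv) by simp only [mul_assoc], hτ₂]; simp only [mul_assoc]
  simp only [mul_add, add_mul, mul_sub, sub_mul, map_add, map_sub, mul_assoc] at e1 e2 e3 ⊢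
  linear_combination e2 - e1 - e3

include hτ₂ hφ hη hU hc₀ in
/-- **THE TRANSPOSE LETTER OF (3.117): `D^{η*}_U ∘ Δ^η(U)` IS AN ORDER-ZERO STENCIL.**  For every bond function `A` and site `x`,
`(D^{η*}_U(Δ^η(U)A))(x) = φ⁻¹((i∕2)·Σ_μ([Ã(x,μ), J(x,μ)] + U(x−e_μ,μ)⁻¹·[Ã(x−e_μ,μ), J(x−e_μ,μ)]·U(x−e_μ,μ)))`, `Ã = φ∘A`, `J = D*η⁻²Im ∂U` the current
(3.11) through the dictionary — no difference quotient of `A`, no `η⁻¹` («one of the three derivatives there has to be applied either to an expression on the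
right, or on the left, of Δ′_π», p. 421: here it lands on the background and becomes `J`).  From `B9Eq3117HessOpGaugeMode.equiv_hessOp_covDerivL2K` by the
bilinear adjointness `tpair_covDerivL2K`, the bilinear symmetry `B9Eq3119DeltaPiCarrier.tpair_hessOp_comm`, traciality and a re-indexing along each direction.
[cite: Balaban1985BackgroundPropagators, (3.117) p.419, (3.120) p.419, p.421] -/
theorem equiv_covDivL2K_hessOp (A : BondL2K ℂ d Pd c₀ W) (x : TSite d Pd) :
    WL2.equiv ℂ _ W (covDivL2K ℂ c₀ ((η : ℂ))⁻¹ (adTransportW φ fun b => (U b)⁻¹) (hessOp φ η U τ A)) x =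
      φ.symm ((I / 2) • ∑ μ : Fin d,
        ((φ (WL2.equiv ℂ _ W A (x, μ)) * B9Eq39Adjoint.J (fun μ => shiftEquiv μ) (fun μ y => U (y, μ)) η μ x -
            B9Eq39Adjoint.J (fun μ => shiftEquiv μ) (fun μ y => U (y, μ)) η μ x * φ (WL2.equiv ℂ _ W A (x, μ))) +
          (((U (unshift μ x, μ))⁻¹ : 𝔸ˣ) : 𝔸) *
              (φ (WL2.equiv ℂ _ W A (unshift μ x, μ)) * B9Eq39Adjoint.J (fun μ => shiftEquiv μ) (fun μ y => U (y, μ)) η μ (unshift μ x) -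
                B9Eq39Adjoint.J (fun μ => shiftEquiv μ) (fun μ y => U (y, μ)) η μ (unshift μ x) * φ (WL2.equiv ℂ _ W A (unshift μ x, μ))) *
            (U (unshift μ x, μ) : 𝔸))) := by
  set Jf : Fin d → TSite d Pd → 𝔸 := B9Eq39Adjoint.J (fun μ => shiftEquiv μ) (fun μ y => U (y, μ)) η with hJf
  set Af : Bond d Pd → 𝔸 := fun b => φ (WL2.equiv ℂ _ W A b) with hAf
  set C : Bond d Pd → 𝔸 := fun b => Af b * Jf b.2 b.1 - Jf b.2 b.1 * Af b with hC
  set K : TSite d Pd → 𝔸 := fun x => (I / 2) • ∑ μ : Fin d,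
    (C (x, μ) + (((U (unshift μ x, μ))⁻¹ : 𝔸ˣ) : 𝔸) * C (unshift μ x, μ) * (U (unshift μ x, μ) : 𝔸)) with hK
  set g : SiteL2K ℂ d Pd c₀ W := (WL2.equiv ℂ (fun _ : TSite d Pd => c₀) W).symm (fun x => φ.symm (K x)) with hg
  suffices h : covDivL2K ℂ c₀ ((η : ℂ))⁻¹ (adTransportW φ fun b => (U b)⁻¹) (hessOp φ η U τ A) = g by
    rw [h]; rfl
  -- non-degeneracy of the bilinear pairing in its FIRST slot: `tpair y · = ⟪starW y, ·⟫`
  suffices key : ∀ l : SiteL2K ℂ d Pd c₀ W,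
      tpair φ τ (covDivL2K ℂ c₀ ((η : ℂ))⁻¹ (adTransportW φ fun b => (U b)⁻¹) (hessOp φ η U τ A)) l = tpair φ τ g l by
    have h1 : starW φ (covDivL2K ℂ c₀ ((η : ℂ))⁻¹ (adTransportW φ fun b => (U b)⁻¹) (hessOp φ η U τ A)) = starW φ g := by
      refine ext_inner_right ℂ fun l => ?_
      rw [← tpair_eq_inner_starW φ τ hφ, ← tpair_eq_inner_starW φ τ hφ, key]
    simpa only [starW_starW] using congrArg (starW φ) h1
  intro l
  set lam : TSite d Pd → 𝔸 := fun y => φ (WL2.equiv ℂ _ W l y) with hlam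
  rw [← tpair_covDerivL2K φ τ hτ₂ hφ η hU, tpair_comm φ τ hτ₂ _ (covDerivL2K _ _ _ _ l),
    tpair_hessOp_comm φ τ hτ₂ hφ η hU (covDerivL2K _ _ _ _ l) A, tpair_def, tpair_def]
  -- left: Σ_b c₀ τ(Ã(b)·(Δ D_U λ)(b)); right: Σ_x c₀ τ(K(x)·λ(x))
  have hL : ∀ b : Bond d Pd, (c₀ : ℂ) * τ (φ (WL2.equiv ℂ _ W A b) *
        φ (WL2.equiv ℂ _ W (hessOp φ η U τ (covDerivL2K ℂ c₀ ((η : ℂ))⁻¹ (adTransportW φ U) l)) b)) =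
      (c₀ : ℂ) * (I / 2) * τ (C b * lam b.1) +
        (c₀ : ℂ) * (I / 2) * τ ((((U b)⁻¹ : 𝔸ˣ) : 𝔸) * C b * (U b : 𝔸) * lam (shift b.2 b.1)) := by
    intro b
    rw [equiv_hessOp_covDerivL2K φ τ hτ₂ hφ hη hU hc₀ l b, LinearEquiv.apply_symm_apply, mul_smul_comm, map_smul, smul_eq_mul,
      trace_transpose τ hτ₂]
    simp only [hC, hAf, hJf, hlam]
    ring
  have hR : ∀ x : TSite d Pd, (c₀ : ℂ) * τ (φ (WL2.equiv ℂ _ W g x) * φ (WL2.equiv ℂ _ W l x)) =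
      ∑ μ : Fin d, ((c₀ : ℂ) * (I / 2) * τ (C (x, μ) * lam x) +
        (c₀ : ℂ) * (I / 2) * τ ((((U (unshift μ x, μ))⁻¹ : 𝔸ˣ) : 𝔸) * C (unshift μ x, μ) * (U (unshift μ x, μ) : 𝔸) * lam x)) := by
    intro x
    have hgx : φ (WL2.equiv ℂ (fun _ : TSite d Pd => c₀) W g x) = K x := by rw [hg]; exact φ.apply_symm_apply _
    rw [hgx, hK, smul_mul_assoc, map_smul, smul_eq_mul, Finset.sum_mul, map_sum, Finset.mul_sum, Finset.mul_sum]
    refine Finset.sum_congr rfl fun μ _ => ?_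
    rw [add_mul, map_add]
    ring
  simp_rw [hL, hR]
  rw [Fintype.sum_prod_type, Finset.sum_comm]
  rw [Finset.sum_comm (γ := TSite d Pd)]
  refine Finset.sum_congr rfl fun μ _ => ?_
  rw [Finset.sum_add_distrib, Finset.sum_add_distrib]
  congr 1
  -- reindex the transported family along the bond: `y ↦ x = y + e_μ`
  exact (Equiv.sum_comp (shiftEquiv μ).symm (fun y : TSite d Pd =>
    (c₀ : ℂ) * (I / 2) * τ ((((U (y, μ))⁻¹ : 𝔸ˣ) : 𝔸) * C (y, μ) * (U (y, μ) : 𝔸) * lam (shift μ y)))).symm.trans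
    (Finset.sum_congr rfl fun x _ => by
      simp only [shiftEquiv, Equiv.coe_fn_symm_mk, shift_unshift])

end DivHess

/-! ## §3 The pointwise letter of `D^{η*}_U ∘ Δ^η(U)` under the window `‖J‖ ≤ j₀` -/

section Bound

open B7Prop1Explicit (U1 mem_U1)

variable {d : ℕ} {Pd : Fin d → ℕ} {𝔸 : Type*} [NormedRing 𝔸] [NormedAlgebra ℂ 𝔸] [NormOneClass 𝔸] [StarRing 𝔸] [StarModule ℂ 𝔸]
  {W : Type*} [NormedAddCommGroup W] [InnerProductSpace ℂ W] [FiniteDimensional ℂ W] (φ : W ≃ₗ[ℂ] 𝔸) {c₀ : ℝ} [Fact (0 < c₀)]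
  (τ : 𝔸 →ₗ[ℂ] ℂ) (hτ₂ : ∀ X Y : 𝔸, τ (X * Y) = τ (Y * X))
  (hφ : ∀ X Y : 𝔸, ⟪φ.symm X, φ.symm Y⟫_ℂ = τ (star X * Y)) {η : ℝ} (hη : η ≠ 0) {U : Bond d Pd → 𝔸ˣ}
  (hU : ∀ b, star (U b : 𝔸) = ((U b)⁻¹ : 𝔸ˣ)) (hc₀ : c₀ = η ^ d) (hUb : ∀ b, U b ∈ U1 𝔸)
  {Mφ Mφ' j₀ : ℝ} (hMφ' : 0 ≤ Mφ') (hφn : ∀ w, ‖φ w‖ ≤ Mφ * ‖w‖) (hφ' : ∀ X, ‖φ.symm X‖ ≤ Mφ' * ‖X‖)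
  (hJ : ∀ μ y, ‖B9Eq39Adjoint.J (fun μ => shiftEquiv μ) (fun μ y => U (y, μ)) η μ y‖ ≤ j₀)

include hτ₂ hφ hη hU hc₀ hUb hMφ' hφn hφ' hJ in
/-- **THE POINTWISE LETTER OF THE TRANSPOSE** under the chain's norming letters and print's third window (3.36) in the shape `‖J‖ ≤ j₀`:
`‖(D^{η*}_U(Δ^η(U)A))(x)‖ ≤ M_φ′·j₀·M_φ·Σ_μ(‖A(x,μ)‖ + ‖A(x−e_μ,μ)‖)` — order zero, no `η⁻¹`. [cite: Balaban1985BackgroundPropagators, (3.117) p.419, (3.36) p.396, p.421] -/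
theorem norm_equiv_covDivL2K_hessOp_le (A : BondL2K ℂ d Pd c₀ W) (x : TSite d Pd) :
    ‖WL2.equiv ℂ _ W (covDivL2K ℂ c₀ ((η : ℂ))⁻¹ (adTransportW φ fun b => (U b)⁻¹) (hessOp φ η U τ A)) x‖ ≤
      Mφ' * j₀ * Mφ * ∑ μ : Fin d, (‖WL2.equiv ℂ _ W A (x, μ)‖ + ‖WL2.equiv ℂ _ W A (unshift μ x, μ)‖) := by
  rw [equiv_covDivL2K_hessOp φ τ hτ₂ hφ hη hU hc₀]
  set Jf : Fin d → TSite d Pd → 𝔸 := B9Eq39Adjoint.J (fun μ => shiftEquiv μ) (fun μ y => U (y, μ)) η with hJf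
  set Af : Bond d Pd → 𝔸 := fun b => φ (WL2.equiv ℂ _ W A b) with hAf
  set C : Bond d Pd → 𝔸 := fun b => Af b * Jf b.2 b.1 - Jf b.2 b.1 * Af b with hC
  set S : 𝔸 := ∑ μ : Fin d, (C (x, μ) + (((U (unshift μ x, μ))⁻¹ : 𝔸ˣ) : 𝔸) * C (unshift μ x, μ) * (U (unshift μ x, μ) : 𝔸)) with hS
  show ‖φ.symm ((I / 2) • S)‖ ≤ _
  have hCle : ∀ b : Bond d Pd, ‖C b‖ ≤ 2 * j₀ * Mφ * ‖WL2.equiv ℂ _ W A b‖ := by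
    intro b
    have hj₀ : 0 ≤ j₀ := (norm_nonneg _).trans (hJ b.2 b.1)
    calc ‖C b‖ ≤ ‖Af b * Jf b.2 b.1‖ + ‖Jf b.2 b.1 * Af b‖ := norm_sub_le _ _
      _ ≤ ‖Af b‖ * ‖Jf b.2 b.1‖ + ‖Jf b.2 b.1‖ * ‖Af b‖ := add_le_add (norm_mul_le _ _) (norm_mul_le _ _)
      _ ≤ ‖Af b‖ * j₀ + j₀ * ‖Af b‖ := by gcongr <;> exact hJ b.2 b.1
      _ = 2 * j₀ * ‖Af b‖ := by ring
      _ ≤ 2 * j₀ * (Mφ * ‖WL2.equiv ℂ _ W A b‖) := mul_le_mul_of_nonneg_left (hφn _) (by positivity)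
      _ = 2 * j₀ * Mφ * ‖WL2.equiv ℂ _ W A b‖ := by ring
  have hterm : ∀ μ : Fin d, ‖C (x, μ) + (((U (unshift μ x, μ))⁻¹ : 𝔸ˣ) : 𝔸) * C (unshift μ x, μ) * (U (unshift μ x, μ) : 𝔸)‖ ≤
      2 * j₀ * Mφ * ‖WL2.equiv ℂ _ W A (x, μ)‖ + 2 * j₀ * Mφ * ‖WL2.equiv ℂ _ W A (unshift μ x, μ)‖ := by
    intro μ
    have hU1 := mem_U1.1 (hUb (unshift μ x, μ))
    have hconj : ‖(((U (unshift μ x, μ))⁻¹ : 𝔸ˣ) : 𝔸) * C (unshift μ x, μ) * (U (unshift μ x, μ) : 𝔸)‖ ≤ ‖C (unshift μ x, μ)‖ := by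
      calc ‖(((U (unshift μ x, μ))⁻¹ : 𝔸ˣ) : 𝔸) * C (unshift μ x, μ) * (U (unshift μ x, μ) : 𝔸)‖
          ≤ ‖(((U (unshift μ x, μ))⁻¹ : 𝔸ˣ) : 𝔸)‖ * ‖C (unshift μ x, μ)‖ * ‖(U (unshift μ x, μ) : 𝔸)‖ :=
            (norm_mul_le _ _).trans (mul_le_mul_of_nonneg_right (norm_mul_le _ _) (norm_nonneg _))
        _ ≤ 1 * ‖C (unshift μ x, μ)‖ * 1 := by gcongr; exacts [hU1.2, hU1.1]
        _ = ‖C (unshift μ x, μ)‖ := by ring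
    calc ‖C (x, μ) + (((U (unshift μ x, μ))⁻¹ : 𝔸ˣ) : 𝔸) * C (unshift μ x, μ) * (U (unshift μ x, μ) : 𝔸)‖
        ≤ ‖C (x, μ)‖ + ‖(((U (unshift μ x, μ))⁻¹ : 𝔸ˣ) : 𝔸) * C (unshift μ x, μ) * (U (unshift μ x, μ) : 𝔸)‖ := norm_add_le _ _
      _ ≤ ‖C (x, μ)‖ + ‖C (unshift μ x, μ)‖ := add_le_add le_rfl hconj
      _ ≤ _ := add_le_add (hCle _) (hCle _)
  have hI : ‖(I / 2 : ℂ)‖ = 2⁻¹ := by simp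
  have hs : ∑ μ : Fin d, (2 * j₀ * Mφ * ‖WL2.equiv ℂ _ W A (x, μ)‖ + 2 * j₀ * Mφ * ‖WL2.equiv ℂ _ W A (unshift μ x, μ)‖) =
      2 * j₀ * Mφ * ∑ μ : Fin d, (‖WL2.equiv ℂ _ W A (x, μ)‖ + ‖WL2.equiv ℂ _ W A (unshift μ x, μ)‖) := by
    rw [Finset.mul_sum]
    exact Finset.sum_congr rfl fun μ _ => by ring
  calc ‖φ.symm ((I / 2) • S)‖ ≤ Mφ' * ‖(I / 2) • S‖ := hφ' _
    _ = Mφ' * (2⁻¹ * ‖S‖) := by rw [norm_smul, hI]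
    _ ≤ Mφ' * (2⁻¹ * ∑ μ : Fin d, (2 * j₀ * Mφ * ‖WL2.equiv ℂ _ W A (x, μ)‖ + 2 * j₀ * Mφ * ‖WL2.equiv ℂ _ W A (unshift μ x, μ)‖)) := by
        gcongr
        exact (norm_sum_le _ _).trans (Finset.sum_le_sum fun μ _ => hterm μ)
    _ = Mφ' * j₀ * Mφ * ∑ μ : Fin d, (‖WL2.equiv ℂ _ W A (x, μ)‖ + ‖WL2.equiv ℂ _ W A (unshift μ x, μ)‖) := by
        rw [hs]; ring

include hτ₂ hφ hη hU hc₀ hUb hMφ' hφn hφ' hJ in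
/-- **The sup letter of the transpose**: `‖A‖_∞ ≤ N` ⟹ `‖(D^{η*}_U(Δ^η(U)A))(x)‖ ≤ 2d·M_φM_φ′j₀·N` at every site.
[cite: Balaban1985BackgroundPropagators, (3.117) p.419, (3.36) p.396] -/
theorem norm_equiv_covDivL2K_hessOp_le_sup (hMφ : 0 ≤ Mφ) (A : BondL2K ℂ d Pd c₀ W) {N : ℝ} (hN : ∀ b, ‖WL2.equiv ℂ _ W A b‖ ≤ N)
    (x : TSite d Pd) :
    ‖WL2.equiv ℂ _ W (covDivL2K ℂ c₀ ((η : ℂ))⁻¹ (adTransportW φ fun b => (U b)⁻¹) (hessOp φ η U τ A)) x‖ ≤ 2 * d * Mφ * Mφ' * j₀ * N := by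
  refine (norm_equiv_covDivL2K_hessOp_le φ τ hτ₂ hφ hη hU hc₀ hUb hMφ' hφn hφ' hJ A x).trans ?_
  rcases Nat.eq_zero_or_pos d with hd | hd
  · subst hd
    simp
  have hj₀ : 0 ≤ j₀ := (norm_nonneg _).trans (hJ ⟨0, hd⟩ x)
  have h2 : ∑ μ : Fin d, (‖WL2.equiv ℂ _ W A (x, μ)‖ + ‖WL2.equiv ℂ _ W A (unshift μ x, μ)‖) ≤ ∑ _μ : Fin d, (N + N) :=
    Finset.sum_le_sum fun μ _ => add_le_add (hN _) (hN _)
  rw [Finset.sum_const, Finset.card_univ, Fintype.card_fin, nsmul_eq_mul] at h2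
  calc Mφ' * j₀ * Mφ * ∑ μ : Fin d, (‖WL2.equiv ℂ _ W A (x, μ)‖ + ‖WL2.equiv ℂ _ W A (unshift μ x, μ)‖)
      ≤ Mφ' * j₀ * Mφ * ((d : ℝ) * (N + N)) := mul_le_mul_of_nonneg_left h2 (mul_nonneg (mul_nonneg hMφ' hj₀) hMφ)
    _ = 2 * d * Mφ * Mφ' * j₀ * N := by ring

end Bound

end Literature.MathematicalPhysics.QuantumFieldTheory.Balaban1983to89.B9Eq3117DivHessOpGaugeMode
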